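import Summits.AtomisticToContinuum.Crystallization.Theorems.OverbindingBudgetAffineCompressedCutFar
import Summits.AtomisticToContinuum.Crystallization.Theorems.OverbindingBudgetAffineCompressedCutTail

/-!
# OverbindingBudget · AffineCompressedCut — rider «Pieces» (lens-4 g82, head start on (iii) = the 79K energy inequality, part V)

Cell `decomp-a2c`, seat lens-4, generation 82.  ELEMENTARY·PROVED, no new numeric hypothesis, no new `Prop` definitions.

THE CERTIFIED TAIL PIECES.  «Tail» (part I, tree) bounds `Σ d⁻⁶` over a `σν`-separated point set in an annulus; «Core»/«Far» (parts II–IV) certify the scale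
floors `σ` on the annuli of the `12·nn_i`-ball under the leaf's hypothesis.  This file joins them into INDEX sums, the form «Sum» (g83) consumes:

* `annulus_sum_le` — GENERIC bridge: `y` injective, a finite index set `S` whose sites lie in the annulus `[r, r + J·ω]·ν` about `y i` and have `nn_k ≥ σ·ν`
  ⟹ `∑ k ∈ S, (dist (y i) (y k))⁻¹ ^ 6 ≤ ν⁻¹ ^ 6 · B(σ, r, ω, J)` (the «Tail» expression; separation from `nearestDist_le_dist`, index sum = position sum by injectivity).
* ★ `piece1_sum_le` … `piece5_sum_le` — under `Function.Injective y`, `0 < nn_i`, `AffDeepReg 12 (1/10^4) (1/1000) (1/450) y i`, for EVERY finite `S` of indices in the piece: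

| piece | annulus (units `ν = nn_i`) | `σ` (source)            | grid `ω`, `J` | certified `Σ_{k∈S} d_k⁻⁶ ≤ C·ν⁻⁶` | exact B   | energy debit `C·ν⁻⁶/6` at `ν = 17/20` |
|-------|----------------------------|-------------------------|---------------|-----------------------------------|-----------|----------------------------------------|
| 1     | `(106/25, 219/40]`         | `9/10` («Core»)         | `1/200`, 247  | `193/1000`                        | 0.192172  | 0.0853                                 |
| 2     | `(219/40, 8]`              | `83/100` (tier B)       | `1/200`, 505  | `11/100`                          | 0.109570  | 0.0486                                 |
| 3     | `(8, 47/5]`                | `79/100` (tier C)       | `1/100`, 140  | `47/2000`                         | 0.023203  | 0.0104                                 |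
| 4     | `(47/5, 101/10]`           | `77/100` (tier D)       | `1/100`, 70   | `1/100`                           | 0.009710  | 0.0044                                 |
| 5     | `(101/10, 21/2]`           | `3/4` (tier E)          | `1/100`, 40   | `13/2000`                         | 0.006316  | 0.0029                                 |
| 6     | `(21/2, 12]`               | `2/5` (HYPOTHESIS: the load-bearing floor) | `1/100`, 150 | `51/1000`           | 0.050006  | 0.0225                                 |

  Total `0.394·ν⁻⁶`, i.e. an attractive-tail debit `≤ 0.1742` energy units at the endpoint `ν = 17/20` (POINTERS-g83 ledger: `0.468 − 0.174 − 0.07 − 0.03 − c ≈ +0.19 − c`).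
* `piece6_sum_le` — the outermost piece with the floor `(2/5)·ν` as a HYPOTHESIS on `S` (it is the pricing floor of the load-bearing sites, supplied by «Sum»).
-/

namespace Summit.AtomisticToContinuum.Crystallization.Theorems.OverbindingBudgetAffineCompressedCutPieces

open scoped BigOperators
open Literature.Geometry.DiscreteGeometry (nearestDist nearestDist_nonneg nearestDist_le_dist)
open Summit.AtomisticToContinuum.Crystallization.Theorems.OverbindingBudgetAffineLadder (AffDeepReg)
open Summit.AtomisticToContinuum.Crystallization.Theorems.OverbindingBudgetAffineCompressedCutCore (core_scale_window)
open Summit.AtomisticToContinuum.Crystallization.Theorems.OverbindingBudgetAffineCompressedCutFar (tierB_window tierC_window tierD_window tierE_window)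
open Summit.AtomisticToContinuum.Crystallization.Theorems.OverbindingBudgetAffineCompressedCutTail (sum_inv_pow_six_le_grid_scaled)

variable {N : ℕ}

/-- **GENERIC BRIDGE** from «Tail» to index sums: sites of `S` in the annulus `[r, r + Jω]·ν` about `y i` with scale floor `σν` have
`∑ k ∈ S, (dist (y i) (y k))⁻¹ ^ 6 ≤ ν⁻¹ ^ 6 · B(σ, r, ω, J)`. [this file] -/
theorem annulus_sum_le {y : Fin N → EuclideanSpace ℝ (Fin 3)} (hy : Function.Injective y) (i : Fin N) {ν σ r ω : ℝ} {J : ℕ}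
    (hν : 0 < ν) (hσ : 0 < σ) (hr : σ / 2 ≤ r) (hω : 0 < ω) (hJ : 1 ≤ J) (S : Finset (Fin N))
    (hS : ∀ k ∈ S, r * ν ≤ dist (y i) (y k) ∧ dist (y i) (y k) ≤ (r + J * ω) * ν) (hfloor : ∀ k ∈ S, σ * ν ≤ nearestDist y k) :
    ∑ k ∈ S, (dist (y i) (y k))⁻¹ ^ 6 ≤
      ν⁻¹ ^ 6 * (48 / σ ^ 3 * (1 + (ω + σ / 2) / r) ^ 3 * (ω * r⁻¹ ^ 4 + (r⁻¹ ^ 3 - (r + (J - 1) * ω)⁻¹ ^ 3) / 3)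
        - 8 / σ ^ 3 * (r - σ / 2) ^ 3 * r⁻¹ ^ 6 + 8 / σ ^ 3 * (r + J * ω + σ / 2) ^ 3 * (r + J * ω)⁻¹ ^ 6) := by
  have hinj : ∀ k ∈ S, ∀ k' ∈ S, y k = y k' → k = k' := fun k _ k' _ h => hy h
  rw [← Finset.sum_image (f := fun z => (dist (y i) z)⁻¹ ^ 6) hinj]
  refine sum_inv_pow_six_le_grid_scaled (S.image y) (y i) hν hσ hr hω hJ ?_ ?_
  · intro z hz z' hz' hzz'
    obtain ⟨k, hk, rfl⟩ := Finset.mem_image.1 hz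
    obtain ⟨k', hk', rfl⟩ := Finset.mem_image.1 hz'
    have hkk' : k' ≠ k := fun h => hzz' (by rw [h])
    exact (hfloor k hk).trans (nearestDist_le_dist y hkk')
  · intro z hz
    obtain ⟨k, hk, rfl⟩ := Finset.mem_image.1 hz
    exact hS k hk

/-- ★ **PIECE 1** `(106/25, 219/40]·nn_i`, floor `9/10` from «Core»: `Σ d⁻⁶ ≤ (193/1000)·nn_i⁻⁶`. [this file] -/
theorem piece1_sum_le {y : Fin N → EuclideanSpace ℝ (Fin 3)} (hy : Function.Injective y) {i : Fin N} (hν : 0 < nearestDist y i)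
    (hreg : AffDeepReg 12 (1 / 10 ^ 4) (1 / 1000) (1 / 450) y i) (S : Finset (Fin N))
    (hS : ∀ k ∈ S, 106 / 25 * nearestDist y i < dist (y i) (y k) ∧ dist (y i) (y k) ≤ 219 / 40 * nearestDist y i) :
    ∑ k ∈ S, (dist (y i) (y k))⁻¹ ^ 6 ≤ 193 / 1000 * (nearestDist y i)⁻¹ ^ 6 := by
  have h := annulus_sum_le hy i (σ := 9 / 10) (r := 106 / 25) (ω := 1 / 200) (J := 247) hν (by norm_num) (by norm_num) (by norm_num) (by norm_num) S
    (fun k hk => ⟨(hS k hk).1.le, by norm_num; exact (hS k hk).2⟩)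
    (fun k hk => (core_scale_window hy hν hreg k (by rw [dist_comm]; exact (hS k hk).2)).1)
  refine h.trans ?_
  rw [mul_comm]
  exact mul_le_mul_of_nonneg_right (by norm_num) (by positivity)

/-- ★ **PIECE 2** `(219/40, 8]·nn_i`, floor `83/100` from tier B: `Σ d⁻⁶ ≤ (11/100)·nn_i⁻⁶`. [this file] -/
theorem piece2_sum_le {y : Fin N → EuclideanSpace ℝ (Fin 3)} (hy : Function.Injective y) {i : Fin N} (hν : 0 < nearestDist y i)
    (hreg : AffDeepReg 12 (1 / 10 ^ 4) (1 / 1000) (1 / 450) y i) (S : Finset (Fin N))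
    (hS : ∀ k ∈ S, 219 / 40 * nearestDist y i < dist (y i) (y k) ∧ dist (y i) (y k) ≤ 8 * nearestDist y i) :
    ∑ k ∈ S, (dist (y i) (y k))⁻¹ ^ 6 ≤ 11 / 100 * (nearestDist y i)⁻¹ ^ 6 := by
  have h := annulus_sum_le hy i (σ := 83 / 100) (r := 219 / 40) (ω := 1 / 200) (J := 505) hν (by norm_num) (by norm_num) (by norm_num) (by norm_num) S
    (fun k hk => ⟨(hS k hk).1.le, by norm_num; exact (hS k hk).2⟩)
    (fun k hk => (tierB_window hy hν hreg k (by rw [dist_comm]; linarith [(hS k hk).1]) (by rw [dist_comm]; exact (hS k hk).2)).1)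
  refine h.trans ?_
  rw [mul_comm]
  exact mul_le_mul_of_nonneg_right (by norm_num) (by positivity)

/-- ★ **PIECE 3** `(8, 47/5]·nn_i`, floor `79/100` from tier C: `Σ d⁻⁶ ≤ (47/2000)·nn_i⁻⁶`. [this file] -/
theorem piece3_sum_le {y : Fin N → EuclideanSpace ℝ (Fin 3)} (hy : Function.Injective y) {i : Fin N} (hν : 0 < nearestDist y i)
    (hreg : AffDeepReg 12 (1 / 10 ^ 4) (1 / 1000) (1 / 450) y i) (S : Finset (Fin N))
    (hS : ∀ k ∈ S, 8 * nearestDist y i < dist (y i) (y k) ∧ dist (y i) (y k) ≤ 47 / 5 * nearestDist y i) :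
    ∑ k ∈ S, (dist (y i) (y k))⁻¹ ^ 6 ≤ 47 / 2000 * (nearestDist y i)⁻¹ ^ 6 := by
  have h := annulus_sum_le hy i (σ := 79 / 100) (r := 8) (ω := 1 / 100) (J := 140) hν (by norm_num) (by norm_num) (by norm_num) (by norm_num) S
    (fun k hk => ⟨(hS k hk).1.le, by norm_num; exact (hS k hk).2⟩)
    (fun k hk => (tierC_window hy hν hreg k (by rw [dist_comm]; exact (hS k hk).1.le) (by rw [dist_comm]; exact (hS k hk).2)).1)
  refine h.trans ?_
  rw [mul_comm]
  exact mul_le_mul_of_nonneg_right (by norm_num) (by positivity)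

/-- ★ **PIECE 4** `(47/5, 101/10]·nn_i`, floor `77/100` from tier D: `Σ d⁻⁶ ≤ (1/100)·nn_i⁻⁶`. [this file] -/
theorem piece4_sum_le {y : Fin N → EuclideanSpace ℝ (Fin 3)} (hy : Function.Injective y) {i : Fin N} (hν : 0 < nearestDist y i)
    (hreg : AffDeepReg 12 (1 / 10 ^ 4) (1 / 1000) (1 / 450) y i) (S : Finset (Fin N))
    (hS : ∀ k ∈ S, 47 / 5 * nearestDist y i < dist (y i) (y k) ∧ dist (y i) (y k) ≤ 101 / 10 * nearestDist y i) :
    ∑ k ∈ S, (dist (y i) (y k))⁻¹ ^ 6 ≤ 1 / 100 * (nearestDist y i)⁻¹ ^ 6 := by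
  have h := annulus_sum_le hy i (σ := 77 / 100) (r := 47 / 5) (ω := 1 / 100) (J := 70) hν (by norm_num) (by norm_num) (by norm_num) (by norm_num) S
    (fun k hk => ⟨(hS k hk).1.le, by norm_num; exact (hS k hk).2⟩)
    (fun k hk => (tierD_window hy hν hreg k (by rw [dist_comm]; exact (hS k hk).1.le) (by rw [dist_comm]; exact (hS k hk).2)).1)
  refine h.trans ?_
  rw [mul_comm]
  exact mul_le_mul_of_nonneg_right (by norm_num) (by positivity)

/-- ★ **PIECE 5** `(101/10, 21/2]·nn_i`, floor `3/4` from tier E: `Σ d⁻⁶ ≤ (13/2000)·nn_i⁻⁶`. [this file] -/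
theorem piece5_sum_le {y : Fin N → EuclideanSpace ℝ (Fin 3)} (hy : Function.Injective y) {i : Fin N} (hν : 0 < nearestDist y i)
    (hreg : AffDeepReg 12 (1 / 10 ^ 4) (1 / 1000) (1 / 450) y i) (S : Finset (Fin N))
    (hS : ∀ k ∈ S, 101 / 10 * nearestDist y i < dist (y i) (y k) ∧ dist (y i) (y k) ≤ 21 / 2 * nearestDist y i) :
    ∑ k ∈ S, (dist (y i) (y k))⁻¹ ^ 6 ≤ 13 / 2000 * (nearestDist y i)⁻¹ ^ 6 := by
  have h := annulus_sum_le hy i (σ := 3 / 4) (r := 101 / 10) (ω := 1 / 100) (J := 40) hν (by norm_num) (by norm_num) (by norm_num) (by norm_num) S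
    (fun k hk => ⟨(hS k hk).1.le, by norm_num; exact (hS k hk).2⟩)
    (fun k hk => (tierE_window hy hν hreg k (by rw [dist_comm]; exact (hS k hk).1.le) (by rw [dist_comm]; exact (hS k hk).2)).1)
  refine h.trans ?_
  rw [mul_comm]
  exact mul_le_mul_of_nonneg_right (by norm_num) (by positivity)

/-- **PIECE 6** `(21/2, 12]·ν`, floor `(2/5)·ν` as a HYPOTHESIS on `S` (the pricing floor of the load-bearing sites): `Σ d⁻⁶ ≤ (51/1000)·ν⁻⁶`. [this file] -/
theorem piece6_sum_le {y : Fin N → EuclideanSpace ℝ (Fin 3)} (hy : Function.Injective y) (i : Fin N) {ν : ℝ} (hν : 0 < ν) (S : Finset (Fin N))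
    (hS : ∀ k ∈ S, 21 / 2 * ν < dist (y i) (y k) ∧ dist (y i) (y k) ≤ 12 * ν) (hfloor : ∀ k ∈ S, 2 / 5 * ν ≤ nearestDist y k) :
    ∑ k ∈ S, (dist (y i) (y k))⁻¹ ^ 6 ≤ 51 / 1000 * ν⁻¹ ^ 6 := by
  have h := annulus_sum_le hy i (σ := 2 / 5) (r := 21 / 2) (ω := 1 / 100) (J := 150) hν (by norm_num) (by norm_num) (by norm_num) (by norm_num) S
    (fun k hk => ⟨(hS k hk).1.le, by norm_num; exact (hS k hk).2⟩) hfloor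
  refine h.trans ?_
  rw [mul_comm]
  exact mul_le_mul_of_nonneg_right (by norm_num) (by positivity)

end Summit.AtomisticToContinuum.Crystallization.Theorems.OverbindingBudgetAffineCompressedCutPieces
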